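import Summits.BirchSwinnertonDyer.BirchSwinnertonDyer.Theorems.GenusKolyvaginAtTwoK4PosTwinBsdRoadNonPhantom
import Summits.BirchSwinnertonDyer.BirchSwinnertonDyer.Theorems.GenusKolyvaginAtTwoPowDvdShaCardAtTwoRTNonPhantomAdditive
import Literature.NumberTheory.EllipticCurves.RootNumberTwistProofs
import Literature.NumberTheory.EllipticCurves.ModularityVersionApProofs
import HarnessLib

/-!
# Route `GenusKolyvaginAtTwo`, K₄⁺ kernel `K4Pos` (stmt-BirchSwinnertonDyer-31469), LINE 33 «twin_bsd_road» v1.3 STUB F4″ —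
# `stub_offCutNonPhantomAtTwo` IS A THEOREM, SIGNATURE VERBATIM: off the cut, a phantom class Kummer at the two places over `2` is zero

Width seat `bsd-line-gk2-p4` g32 (cell `bsd-f1-sign2`), WIDTH-5 attach on route `GenusKolyvaginAtTwo` rev 59; director rulings (642)(2)/(644)(b).
`--supports stmt-BirchSwinnertonDyer-31469 --as helper`.  THEOREMS ONLY (no definition, no named fact, no `sorry`); standard axioms.
**BSD is NOT proved by this file; `K4Pos` is NOT proved; no item is closed by it** ((644)(a): the wall road is inter-route census only).

WHAT.  The pen's v1.3 put LINE 33's only shortest-path stub in 2-ADIC FORM: F4″ `stub_offCutNonPhantomAtTwo` = on the off-cut K₄⁺ cell with `2`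
split in `K`, every class of `H¹(K, E[2^L])` (`L ≥ 1`) dying on `Γ_{K(E[2^L])}` that is Kummer AT THE PLACES OF `K` OVER `2` is zero.  This is the
all-places form `…RealWitness.offCutNonPhantom_of_twoSplit` (this seat, p782733: the real place is the witness, the K₄⁺ real clause forwards it to a
finite prime) PLUS the tree's SILENCE theorems for the places over `2N` not over `2`: such a place `w` lies over an ODD prime `ℓ ∣ N`, which off the
cut is ADDITIVE (`hoff`: no odd multiplicative prime; `ℓ ∣ N`: not good, `dvd_conductorNorm_iff_not_hasGoodReductionAtPrime`), has `c_ℓ` odd (`C(E)`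
odd) and degree one in `K` (Heegner, `ramificationIdx_eq_one_and_inertiaDeg_eq_one_of_natCast_mem_of_satisfiesHeegnerHypothesis`), so EVERY class is
Kummer at `w` (`H¹(ℚ_ℓ, E[2^k]) = 0`, gk2-p5 g20 `NonPhantom.mem_selmerLocalKer_and_mem_torsionLocalKer_baseChange_of_degree_one`).  Hence:
* ★★ `offCutNonPhantomAtTwo_of_twoSplit` — **LINE 33 v1.3 `stub_offCutNonPhantomAtTwo` with its binders and conclusion VERBATIM** (plug:
  `stub_offCutNonPhantomAtTwo := …RealWitness.offCutNonPhantomAtTwo_of_twoSplit`, no other edit; the binders `hcm`, `hr0`, `h3` are idle).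
READING: with this, LINE 33 has NO open stub on its shortest path (`K4Pos_of_wall_U2_nonPhantom : WALL rows → U₂ → Q2 → PRINT → K4Pos`); census
(inter-route): K₄⁺ has no private content modulo {WALL row 1, U₂, Q2, PRINT}.  The K₄⁻ mirror (LINE 34 F4″⁻, `Δ < 0`) is NOT touched: there the
real place is silent and F4″⁻ is the per-curve 2-adic question «is the Lawson–Wuthrich class a Kummer class at `ℚ₂`».  BSD is NOT proved by this.

References: [LawsonWuthrich2016] §7.1, §8; [MazurRubin2010] Lemma 3.2; [MilneADT2006] I Cor. 2.3, Thm. 2.8; [SilvermanAEC2009] VII.2.1, VII.3.1;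
[GrossLMS1991] §1, §6.
-/

set_option autoImplicit false
set_option linter.dupNamespace false -- `Summit.<P>.<Sub>` repeats `BirchSwinnertonDyer` (D-0017)

noncomputable section

open scoped Classical NumberField

namespace Summit.BirchSwinnertonDyer.BirchSwinnertonDyer.Theorems.GenusExact.Lw2PhantomExclusion.RealWitness

open WeierstrassCurve Field NumberField IsDedekindDomain Rat.HeightOneSpectrum
open Literature.NumberTheory.EllipticCurves Literature.NumberTheory.GaloisRepresentations
open Summit.BirchSwinnertonDyer.BirchSwinnertonDyer.Theorems.GenusExact.VisiblePairAtTwo (natCast_prime_mem_iff_eq)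

/-! ## §5 Off the cut, the places over `N` not over `2` are silent -/

/-- **Off the cut, every class of `H¹(K, E_K[2^k])` is Kummer at every place of `K` over `2N` that is not over `2`.**  `W/ℚ` globally minimal
elliptic with `C(W)` odd and NO odd multiplicative prime; `K` imaginary quadratic with the Heegner hypothesis for `N_W`; `w ∋ 2N_W` a place of `K`
with `2 ∉ w`.  Then the prime `ℓ` under `w` is odd, divides `N_W`, is additive for `W` with `c_ℓ` odd, and `w` has degree one — so
`H¹(K_w, E[2^k]) = 0` swallows every class (gk2-p5 g20's silence theorem). [cite: MilneADT2006, Ch. I, Cor. 2.3 and Thm. 2.8]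
[cite: SilvermanAEC2009, VII.2 Prop. 2.1, VII.3 Prop. 3.1] [cite: GrossLMS1991, §1] -/
theorem mem_selmerLocalKer_baseChange_of_offCut_of_two_notMem
    (W : WeierstrassCurve ℚ) [W.IsElliptic] [W.IsGloballyMinimal] [NeZero (W.conductorNorm ℤ)] (hT : Odd W.tamagawaProduct)
    (hoff : ¬ ∃ v : HeightOneSpectrum (𝓞 ℚ), ((2 : ℕ) : 𝓞 ℚ) ∉ v.asIdeal ∧ ((W.conductorNorm ℤ : ℕ) : 𝓞 ℚ) ∈ v.asIdeal ∧
      W.HasMultiplicativeReductionAt v)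
    {K : Type} [Field K] [NumberField K] (hIQ : IsImaginaryQuadratic K) (hHe : SatisfiesHeegnerHypothesis (W.conductorNorm ℤ) K)
    (w : HeightOneSpectrum (𝓞 K)) (h2Nw : ((2 * W.conductorNorm ℤ : ℕ) : 𝓞 K) ∈ w.asIdeal) (h2w : ((2 : ℕ) : 𝓞 K) ∉ w.asIdeal)
    (k : ℕ) (z : galH1Torsion (W.baseChange K) ((2 ^ k : ℕ) : ℤ)) :
    z ∈ selmerLocalKer (W.baseChange K) (w.adicCompletion K) ((2 ^ k : ℕ) : ℤ) := by
  have hN0 : W.conductorNorm ℤ ≠ 0 := NeZero.ne _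
  -- `w ∋ N`
  have hNw : ((W.conductorNorm ℤ : ℕ) : 𝓞 K) ∈ w.asIdeal := by
    rw [Nat.cast_mul] at h2Nw
    exact (w.isPrime.mem_or_mem h2Nw).resolve_left h2w
  -- the rational place `v` under `w` and its prime `ℓ`
  set v : HeightOneSpectrum (𝓞 ℚ) := w.under (𝓞 ℚ) with hvdef
  have hunder : ∀ n : ℕ, (n : 𝓞 K) ∈ w.asIdeal ↔ (n : 𝓞 ℚ) ∈ v.asIdeal := fun n ↦ by
    change _ ↔ (n : 𝓞 ℚ) ∈ w.asIdeal.under (𝓞 ℚ)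
    rw [Ideal.under_def, Ideal.mem_comap, map_natCast]
  have hNv : ((W.conductorNorm ℤ : ℕ) : 𝓞 ℚ) ∈ v.asIdeal := (hunder _).mp hNw
  have h2v : ((2 : ℕ) : 𝓞 ℚ) ∉ v.asIdeal := fun h ↦ h2w ((hunder 2).mpr h)
  obtain ⟨ℓ, hℓp, hℓN, hℓv⟩ := v.asIdeal.exists_prime_dvd_and_natCast_mem hN0 hNv
  have hveq : v = primesEquiv.symm ⟨ℓ, hℓp⟩ := (natCast_prime_mem_iff_eq hℓp v).mp hℓv
  have hvℓ : ((primesEquiv v : Nat.Primes) : ℕ) = ℓ := by rw [hveq, Equiv.apply_symm_apply]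
  subst hvℓ
  haveI : Fact ((primesEquiv v : Nat.Primes) : ℕ).Prime := ⟨hℓp⟩
  have hℓw : (((primesEquiv v : Nat.Primes) : ℕ) : 𝓞 K) ∈ w.asIdeal := (hunder _).mpr hℓv
  have hℓ2 : ((primesEquiv v : Nat.Primes) : ℕ) ≠ 2 := by
    intro h
    rw [h] at hℓv
    exact h2v hℓv
  -- `ℓ ∣ N`: not good; off the cut: not multiplicative
  have hng : ¬ W.HasGoodReductionAtPrime ((primesEquiv v : Nat.Primes) : ℕ) :=
    (W.dvd_conductorNorm_iff_not_hasGoodReductionAtPrime _).mp hℓN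
  have hnm : ¬ W.HasMultiplicativeReductionAtPrime ((primesEquiv v : Nat.Primes) : ℕ) := fun hm ↦
    hoff ⟨v, h2v, hNv, (W.hasMultiplicativeReductionAtPrime_iff_hasMultiplicativeReductionAt_ringOfIntegers v).mp hm⟩
  -- degree one (Heegner) and silence
  obtain ⟨he, hf⟩ :=
    ramificationIdx_eq_one_and_inertiaDeg_eq_one_of_natCast_mem_of_satisfiesHeegnerHypothesis hIQ.1 hHe hN0 w hNw
  exact (NonPhantom.mem_selmerLocalKer_and_mem_torsionLocalKer_baseChange_of_degree_one W _ hℓ2 hng hnm hT K w hℓw he hf k z).1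

/-! ## §6 ★★ LINE 33 v1.3 F4″ `stub_offCutNonPhantomAtTwo`, VERBATIM -/

/-- ★★ **F4″ — THE 2-ADIC FORM — IS A THEOREM (LINE 33 v1.3 `stub_offCutNonPhantomAtTwo`, binders and conclusion VERBATIM).**  For `E = W` on the
off-cut K₄⁺ cell (non-CM, `r_an = 0`, `ρ_{E,2^n}` onto, `C(E)` odd, `Δ_E > 0`, `#Sel₂(E) = 4` with a `2`-Selmer class non-trivial at `∞`, NO odd
multiplicative prime) and an admissible `K` (imaginary quadratic, `d_K` odd `≠ −3`, Heegner, the two B₂ non-squares) in which `2` SPLITS: for every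
`L ≥ 1`, a class `z ∈ H¹(K, E[2^L])` dying on `Γ_{K(E[2^L])}` that is a Kummer class AT THE PLACES OF `K` OVER `2` is ZERO.  Proof:
`nonPhantom_pow_of_realClause` (the real place is the witness; the real clause forwards it to a finite prime; g31's `E`-intrinsic criterion) wants the
Kummer condition at the places over `2N`; at those not over `2` it is automatic off the cut (`mem_selmerLocalKer_baseChange_of_offCut_of_two_notMem`).
PLUG (pen): `stub_offCutNonPhantomAtTwo := …RealWitness.offCutNonPhantomAtTwo_of_twoSplit`.  BSD is NOT proved by this; `K4Pos` is NOT proved.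
[cite: LawsonWuthrich2016, §7.1, §8] [cite: MazurRubin2010, Lemma 3.2] [cite: MilneADT2006, Ch. I, Cor. 2.3 and Thm. 2.8] -/
theorem offCutNonPhantomAtTwo_of_twoSplit
    (W : WeierstrassCurve ℚ) [W.IsElliptic] [W.IsGloballyMinimal] [NeZero (W.conductorNorm ℤ)]
    (_hcm : ¬ W.HasCM) (_hr0 : W.analyticRank = 0) (hρ : ∀ n : ℕ, 0 < n → W.HasSurjectiveModNGaloisRep ((2 : ℤ) ^ n))
    (hT : Odd W.tamagawaProduct) (hpos : 0 < W.Δ)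
    (h4 : Nat.card (W.selmerGroup 2) = 4 ∧ ∃ c ∈ (W.kummerSelmerStructure ((2 : ℕ) : ℤ)).selmerGroup,
      galoisCohomology.localization (W.torsionGaloisModule ((2 : ℕ) : ℤ)) (Sum.inl Rat.infinitePlace) 1 c ≠ 0)
    (hoff : ¬ ∃ v : HeightOneSpectrum (𝓞 ℚ), ((2 : ℕ) : 𝓞 ℚ) ∉ v.asIdeal ∧ ((W.conductorNorm ℤ : ℕ) : 𝓞 ℚ) ∈ v.asIdeal ∧
      W.HasMultiplicativeReductionAt v)
    (K : Type) [Field K] [NumberField K] (hIQ : IsImaginaryQuadratic K) (hodd : Odd (NumberField.discr K))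
    (_h3 : NumberField.discr K ≠ -3) (hHe : SatisfiesHeegnerHypothesis (W.conductorNorm ℤ) K)
    (hsq1 : ¬ IsSquare ((NumberField.discr K : ℚ) * -|W.Δ|)) (hsq2 : ¬ IsSquare ((NumberField.discr K : ℚ) * (-(2 * |W.Δ|))))
    (h2K : ((Ideal.span {(2 : ℤ)}).primesOver (𝓞 K)).ncard = 2) :
    ∀ (L : ℕ), 1 ≤ L → ∀ z : galH1Torsion (W.baseChange K) ((2 ^ L : ℕ) : ℤ),
      (∀ ρ' ∈ torsionFixing (W.baseChange K) ((2 ^ L : ℕ) : ℤ), h1Eval (W.baseChange K) ((2 ^ L : ℕ) : ℤ) z ρ' = 0) →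
      (∀ w : HeightOneSpectrum (𝓞 K), ((2 : ℕ) : 𝓞 K) ∈ w.asIdeal →
        z ∈ selmerLocalKer (W.baseChange K) (w.adicCompletion K) ((2 ^ L : ℕ) : ℤ)) → z = 0 := by
  intro L hL z hz hw2
  have hreal : ∃ c ∈ W.selmerGroup ((2 : ℕ) : ℤ),
      galoisCohomology.localization (W.torsionGaloisModule ((2 : ℕ) : ℤ)) (Sum.inl Rat.infinitePlace) 1 c ≠ 0 := by
    obtain ⟨c, hc, hne⟩ := h4.2
    exact ⟨c, (SetLike.ext_iff.mp (W.selmerGroup_eq_selmerGroup_kummerSelmerStructure _) c).mpr hc, hne⟩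
  refine nonPhantom_pow_of_realClause W hpos hρ hreal hIQ hodd hsq1 hsq2 (NeZero.ne _) hHe h2K L hL z hz fun w h2Nw ↦ ?_
  by_cases h2w : ((2 : ℕ) : 𝓞 K) ∈ w.asIdeal
  · exact hw2 w h2w
  · exact mem_selmerLocalKer_baseChange_of_offCut_of_two_notMem W hT hoff hIQ hHe w h2Nw h2w L z

end Summit.BirchSwinnertonDyer.BirchSwinnertonDyer.Theorems.GenusExact.Lw2PhantomExclusion.RealWitness

end
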